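import Mathlib
import Summits.SmoothPoincare4.SmoothPoincare4.Theorems.CylinderEntropyCylinderRungTwoKCertSoundTabRaw
import Summits.SmoothPoincare4.SmoothPoincare4.Theorems.CylinderEntropyCylinderRungTwoKCertSoundTabOK
import Summits.SmoothPoincare4.SmoothPoincare4.Theorems.CylinderEntropyCylinderRungTwoKCertSoundBox
import HarnessLib

/-!
# Kernel certificate checker for `stub_certMid`, VI: soundness of the table entries

Infrastructure file for the kernel-clean discharge of the registered stub `stub_certMid` of crux stmt-SmoothPoincare4-7631
(`Summit.SmoothPoincare4.SmoothPoincare4.Theses.CylinderEntropy.CylinderRungTwo`, line `killing-flux`).  The semantic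
specification `TabOK C a tab` of an atom's table along the θ-grid (values, slopes, cell lower bounds, `e^{f(θ_i)}` upper
bounds) and its proof for the computed tables `tabOfRaw C a (rawTab C a) dlo dhi` (any slope data `dlo, dhi`: the effective
slopes are verified inside the checker), hence for `tabsFrom C raws` whenever `raws` agrees with `rawTab` atom by atom.
No named facts.
-/

-- the registered namespace `Summit.SmoothPoincare4.SmoothPoincare4.…` repeats a component
set_option linter.dupNamespace false

noncomputable section

namespace Summit.SmoothPoincare4.SmoothPoincare4.Cruxes.CylinderRungTwo.KillingFlux

namespace KCert

open Set
open Summit.SmoothPoincare4.SmoothPoincare4.Theorems.CylinderEntropySliceIsolation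
open Summit.SmoothPoincare4.SmoothPoincare4.Theorems.CylinderEntropySliceIsolation.Cert

variable (C : KCell)

/-- **The computed table entries meet the specification.** [folklore] -/
theorem tabEntry_spec {a : KAtom} (ha : atomOK C a = true) (hg : gridOK C = true) (dlo dhi : List ℚ) {i : ℕ}
    (hi : i < C.grid.length) :
    let e := tabEntry C a (rawTab C a) dlo dhi i
    0 ≤ e.zlo ∧ ((e.zlo : ℚ) : ℝ) ≤ a.Zc (C.th i) ∧ a.Zc (C.th i) ≤ ((e.zhi : ℚ) : ℝ) ∧
    0 ≤ e.mlo ∧ ((e.mlo : ℚ) : ℝ) ≤ a.fd (C.th i) ∧ a.fd (C.th i) ≤ ((e.mhi : ℚ) : ℝ) ∧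
    0 ≤ e.cello ∧
    (i + 1 < C.grid.length → ∀ θ, C.th i ≤ θ → θ ≤ C.th (i + 1) → ((e.cello : ℚ) : ℝ) ≤ a.Zc θ) ∧
    Real.exp (a.f (C.th i)) ≤ ((e.expf : ℚ) : ℝ) := by
  intro e
  obtain ⟨hz0, hzlo, hzhi, hpos⟩ := rawTab_spec C ha hg hi
  obtain ⟨hm0, hmlo⟩ := mloEff_spec C ha hg dlo hi
  have hmhi := mhiEff_spec C ha hg dhi hi
  obtain ⟨_, hpt, _⟩ := gridOK_sound C hg
  have hτ := tau_pos C ha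
  obtain ⟨_, _, _, htlo, htloτ, hτthi, _⟩ := atomOK_sound C ha
  have htlo0 : (0 : ℝ) < a.tlo := by exact_mod_cast htlo
  set gi := C.grid.getD i gridD with hgi
  set gn := C.grid.getD (i + 1) gridD with hgn
  have hth : C.th i = gi.theta := rfl
  have hthn : C.th (i + 1) = gn.theta := rfl
  obtain ⟨_, _, htli0, htli, hthii, hθπ⟩ := hpt i hi
  rw [← hgi] at htli0 htli hthii hθπ
  have hθ0 : 0 ≤ gi.theta := le_trans (by exact_mod_cast htli0) htli
  -- unfold the entry
  have he : e = tabEntry C a (rawTab C a) dlo dhi i := rfl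
  simp only [tabEntry] at he
  rw [← hgi, ← hgn] at he
  have ez : e.zlo = ((rawTab C a).getD i (0, 0)).1 := by rw [he]
  have eh : e.zhi = ((rawTab C a).getD i (0, 0)).2 := by rw [he]
  have eml : e.mlo = mloEff C a (rawTab C a) dlo i := by rw [he]
  have emh : e.mhi = mhiEff C a (rawTab C a) dhi i := by rw [he]
  have ece : e.cello = min ((rawTab C a).getD i (0, 0)).1
      (if 0 < ((rawTab C a).getD i (0, 0)).1 ∧ i + 1 < C.grid.length then
        rdn (((rawTab C a).getD i (0, 0)).1 * expLo (mloEff C a (rawTab C a) dlo i * (gn.tlo - gi.thi) -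
          (gn.thi ^ 2 - gi.tlo ^ 2) / (4 * a.tlo)) C.prec) C.prec else 0) := by rw [he]
  have eex : e.expf = rup (((rawTab C a).getD i (0, 0)).2 * expHi (gi.thi ^ 2 / (4 * a.tlo)) C.prec) C.prec := by rw [he]
  refine ⟨by rw [ez]; exact hz0, by rw [ez, hth]; exact hzlo, by rw [eh, hth]; exact hzhi, by rw [eml]; exact hm0,
    by rw [eml, hth]; exact hmlo, by rw [emh, hth]; exact hmhi, ?_, ?_, ?_⟩
  · -- `0 ≤ cello`
    rw [ece]
    refine le_min hz0 ?_
    split_ifs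
    · exact rdn_nonneg (mul_nonneg hz0 (expLo_nonneg _ _)) _
    · exact le_rfl
  · -- the cell lower bound
    intro hn θ h1 h2
    rw [ece]
    rcases le_or_gt ((rawTab C a).getD i (0, 0)).1 0 with hzi | hzi
    · refine le_trans ?_ (Zc_pos C ha θ).le
      push_cast
      refine (min_le_left _ _).trans ?_
      exact_mod_cast hzi
    · rw [if_pos ⟨hzi, hn⟩]
      push_cast
      refine (min_le_right _ _).trans ?_
      refine rdn_le_real_of_le ?_ _
      push_cast
      -- `zi · expLo(B) ≤ zi e^B ≤ Zc θ_{i+1} ≤ Zc θ`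
      obtain ⟨_, _, htln0, htln, hthn', hθnπ⟩ := hpt (i + 1) hn
      rw [← hgn] at htln0 htln hthn' hθnπ
      have hzi' : (0 : ℝ) < ((((rawTab C a).getD i (0, 0)).1 : ℚ) : ℝ) := by exact_mod_cast hzi
      have hlt : gi.theta < gn.theta := by
        have := theta_lt_succ C hg hn; rwa [← hgi, ← hgn] at this
      set B : ℚ := mloEff C a (rawTab C a) dlo i * (gn.tlo - gi.thi) - (gn.thi ^ 2 - gi.tlo ^ 2) / (4 * a.tlo) with hB
      have hmlo' : ((mloEff C a (rawTab C a) dlo i : ℚ) : ℝ) ≤ a.fd gi.theta := hth ▸ hmlo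
      have hzlo' : ((((rawTab C a).getD i (0, 0)).1 : ℚ) : ℝ) ≤ a.Zc gi.theta := hth ▸ hzlo
      have hstep : ((((rawTab C a).getD i (0, 0)).1 : ℚ) : ℝ) * ((expLo B C.prec : ℚ) : ℝ) ≤ a.Zc gn.theta := by
        refine le_trans (mul_le_mul_of_nonneg_left (expLo_le _ _) hzi'.le) ?_
        refine Zc_ge_tangent C ha hlt.le hmlo' hzi' hzlo' ?_
        rw [hB]; push_cast
        have hm0' : (0 : ℝ) ≤ mloEff C a (rawTab C a) dlo i := by exact_mod_cast hm0
        have hd : ((gn.tlo : ℝ) - gi.thi) ≤ gn.theta - gi.theta := by linarith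
        have h1' : (mloEff C a (rawTab C a) dlo i : ℝ) * ((gn.tlo : ℝ) - gi.thi) ≤
            (mloEff C a (rawTab C a) dlo i : ℝ) * (gn.theta - gi.theta) := mul_le_mul_of_nonneg_left hd hm0'
        -- the quadratic term
        have hθn0 : 0 ≤ gn.theta := hθ0.trans hlt.le
        have htli0' : (0 : ℝ) ≤ gi.tlo := by exact_mod_cast htli0
        have hp1 : gn.theta ^ 2 ≤ (gn.thi : ℝ) ^ 2 := pow_le_pow_left₀ hθn0 hthn' 2
        have hp2 : (gi.tlo : ℝ) ^ 2 ≤ gi.theta ^ 2 := pow_le_pow_left₀ htli0' htli 2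
        have hp3 : gi.theta ^ 2 ≤ gn.theta ^ 2 := pow_le_pow_left₀ hθ0 hlt.le 2
        have hsq1 : gn.theta ^ 2 - gi.theta ^ 2 ≤ (gn.thi : ℝ) ^ 2 - (gi.tlo : ℝ) ^ 2 := by linarith
        have hsq0 : 0 ≤ gn.theta ^ 2 - gi.theta ^ 2 := by linarith
        have h2' : (gn.theta ^ 2 - gi.theta ^ 2) / (4 * a.tau) ≤ ((gn.thi : ℝ) ^ 2 - (gi.tlo : ℝ) ^ 2) / (4 * a.tlo) := by
          calc (gn.theta ^ 2 - gi.theta ^ 2) / (4 * a.tau) ≤ (gn.theta ^ 2 - gi.theta ^ 2) / (4 * a.tlo) := by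
                apply div_le_div_of_nonneg_left hsq0 (by positivity); linarith
            _ ≤ ((gn.thi : ℝ) ^ 2 - (gi.tlo : ℝ) ^ 2) / (4 * a.tlo) := div_le_div_of_nonneg_right hsq1 (by positivity)
        linarith
      have hmono : a.Zc gn.theta ≤ a.Zc θ := by
        rw [hthn] at h2
        exact Zc_antitone C ha (hθ0.trans (hth ▸ h1)) h2 hθnπ
      exact hstep.trans hmono
  · -- `e^{f θ_i} = Zc θ_i · e^{θ_i²/(4τ)} ≤ hi · expHi(thi²/(4 tlo))`
    rw [eex]
    refine le_rup_real_of_le ?_ _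
    push_cast
    have hf : Real.exp (a.f (C.th i)) = a.Zc gi.theta * Real.exp (gi.theta ^ 2 / (4 * a.tau)) := by
      rw [Zc_eq_exp C ha, ← Real.exp_add, hth]; ring_nf
    rw [hf]
    refine mul_le_mul (hth ▸ hzhi) ?_ (by positivity) (by exact_mod_cast hpos.le)
    have harg : gi.theta ^ 2 / (4 * a.tau) ≤ (((gi.thi ^ 2 / (4 * a.tlo) : ℚ)) : ℝ) := by
      push_cast
      have hp : gi.theta ^ 2 ≤ (gi.thi : ℝ) ^ 2 := pow_le_pow_left₀ hθ0 hthii 2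
      calc gi.theta ^ 2 / (4 * a.tau) ≤ (gi.thi : ℝ) ^ 2 / (4 * a.tau) :=
            div_le_div_of_nonneg_right hp (by positivity)
        _ ≤ (gi.thi : ℝ) ^ 2 / (4 * a.tlo) := by
            apply div_le_div_of_nonneg_left (by positivity) (by positivity); linarith
    exact (Real.exp_le_exp.2 harg).trans (exp_le_expHi (gi.thi ^ 2 / (4 * a.tlo)) C.prec)

/-- **The computed tables meet the specification** (any slope data). [folklore] -/
theorem tabOfRaw_spec {a : KAtom} (ha : atomOK C a = true) (hg : gridOK C = true) (dlo dhi : List ℚ) :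
    TabOK C a (tabOfRaw C a (rawTab C a) dlo dhi) := by
  refine ⟨by simp [tabOfRaw], fun i hi => ?_⟩
  have hget : (tabOfRaw C a (rawTab C a) dlo dhi).getD i tabD = tabEntry C a (rawTab C a) dlo dhi i := by
    unfold tabOfRaw
    rw [List.getD_eq_getElem _ _ (by simpa using hi), List.getElem_map, List.getElem_range]
  rw [hget]
  exact tabEntry_spec C ha hg dlo dhi hi

/-- **Tables from verified raw tables**: if `raws` agrees with `rawTab` atom by atom, `tabsFrom C raws` meets the
specification atom by atom. [folklore] -/
theorem tabsFrom_spec (hat : atomsOK C C.atoms = true) (hg : gridOK C = true) (raws : List (List (ℚ × ℚ)))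
    (hraw : ∀ j, j < C.atoms.length → rawTab C (C.atoms.getD j atomD) = raws.getD j []) :
    List.Forall₂ (TabOK C) C.atoms (tabsFrom C raws) := by
  rw [List.forall₂_iff_get]
  refine ⟨by simp [tabsFrom], fun j hj hj' => ?_⟩
  simp only [tabsFrom, List.get_eq_getElem, List.getElem_map, List.getElem_range]
  have hatom : C.atoms.getD j atomD = C.atoms[j] := List.getD_eq_getElem _ _ hj
  rw [← hraw j hj, hatom]
  exact tabOfRaw_spec C (atomsOK_forall C hat _ (List.getElem_mem hj)) hg _ _

end KCert


/-- Registered sub-goal marker `stub_certMid_part7` of crux stmt-SmoothPoincare4-7631 (helper file 7 of the kernel-clean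
`stub_certMid`, line killing-flux): every atom of a validated atom list is validated. [folklore] -/
theorem stub_certMid_part7 : ∀ (C : KCert.KCell) (l : List KCert.KAtom), KCert.atomsOK C l = true → ∀ a ∈ l, KCert.atomOK C a = true :=
  fun C _ h => KCert.atomsOK_forall C h

end Summit.SmoothPoincare4.SmoothPoincare4.Cruxes.CylinderRungTwo.KillingFlux

end
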